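import Literature.Barriers.CriticalPhenomena.GridSAWDrawnSubgraph
import HarnessLib

/-!
# Barrier `GridSAWCountingSharpPComplete`, tower step: the counting identity
# "SAWs of length `h` = Hamiltonian paths" for uniformly drawn graphs

Sibling of `GridSAWCountingSharpPComplete.lean` (the barrier: Liśkiewicz–Ogihara–Toda 2003,
Theorem 7 (1) ∧ (4)), `GridSAWCountingViaGridHamPath.lean` (the pivot `GRIDHAMPATHCOUNT` —
`#HamPath` for graphs of maximum degree three presented with a congestion-free grid drawing
`(P, D, s, t)`, `IsGridDrawing`, `IsHamPath`, `hamPathCount` — and the named sub-fact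
`LOT2003_thm7_fixedLength_towers : GRIDHAMPATHCOUNT ≤ᵖ_{parsimonious} SAWCOUNT₁`) and
`GridSAWDrawnSubgraph.lean` (the realised subgraph `E₀ = drawnEdges D`, `translate`, `enlarge`).
The tower step has three parts: (T1) the geometric uniformisation `E₀ ↦ E₁ ↦ E₂` (every edge of
`G′` realised by a grid path of the same length `L²`), (T2) the counting identity for uniform
drawings, (T3) polynomial-time computability of the instance map. This file PROVES (T2), the two
sentences of the printed proof that carry the correctness of `R₁(x) = (E₂, τ, h)`:

> "Let `h = L²(N + 1)`. Since `G′` has `N + 2` nodes, every Hamiltonian path of `G′` is realized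
> by a path in `E₂` of length `h`. Furthermore, every path in `E₂` having length `h` corresponds
> to a Hamiltonian path in `G′`. So, regardless of whether the end points of paths are specified
> or not, the number of SAWs in `E₂` having length `h` is exactly the number of Hamiltonian paths
> in `G′`." [LOT2003, §4, proof of Theorem 7, PDF p. 11]

## What is formalised (namespace `Literature.Barriers.CriticalPhenomena.GridSAW`)

For a congestion-free grid drawing `(P, D)` (`IsGridDrawing`: distinct vertex images `P`, every
edge `(i, j, π) ∈ D` drawn as a self-avoiding grid path `π` from `P[i]` to `P[j]` meeting `P`
only at its ends, no two edges with the same ends, two edges meeting only in vertex images):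

* `HasEnds`, `otherEnd`, `orientedPath e a` (the path of `e` read from its end `a`) and the
  structure of `E₀ = drawnEdges D` around a drawn edge: interior points are not vertex images
  (`getElem_orientedPath_not_mem`), hence have no other drawn edge through them;
* **following lemma** `getElem_eq_orientedPath`: a self-avoiding chain of `E₀` whose first two
  points are the first two points of an oriented drawn path agrees with it on all common
  indices — a walk that enters an edge traverses it (degree two inside, no turning back);
* abstract simple paths `IsAbsPath N D l` (distinct vertices `< N`, consecutive ones `DAdj`),
  their **realisation** `realize P D l` (image of the first vertex, then the oriented paths of
  the consecutive edges), and the inverse reading `abstractOf P ω` (indices of the vertex images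
  on `ω`); `realize_cons_cons` (unfolding along the first edge);
* **decomposition** `exists_absPath_realize_eq`: every self-avoiding chain of `E₀` from a vertex
  image to a vertex image is `realize` of an abstract simple path (induction on the length with
  the following lemma; a walk cannot stop inside an edge since its last point is an image);
* **realisations are SAWs**: `isChain_realize`, `nodup_realize` (distinct vertices have distinct
  images, interiors avoid images, distinct edges share no interior point), `getLast?_realize`,
  `length_realize` (under uniform length `ℓ + 1` of all drawn paths: `ℓ · #steps + 1` points),
  `abstractOf_realize` (left inverse, so `realize` is injective on abstract paths);
* `isHamPath_iff` (Hamiltonian = abstract simple path of length `N` with the given ends) and the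
  **counting identity** `ncard_saw_fixedLength_eq_hamPathCount`: for a uniform drawing with
  `N ≥ 2` vertices, the SAWs of `E₀` from `P[s]` to `P[t]` with `ℓ (N - 1) + 1` points are
  equinumerous (via `realize`) with the Hamiltonian `s`–`t` paths; in instance form, after
  moving `P[s]` to the origin (`isSAWIn_translate_iff`, `sawCountFixedLength_translate`):
  `sawCountFixedLength (E₀ - P[s]) (P[t] - P[s]) (ℓ (N - 1)) = hamPathCount N D s t`
  (`sawCountFixedLength_drawnEdges_eq_hamPathCount`); and `hamPathCount_eq_of_map_ends_eq`
  (re-drawing the edges, as (T1) does, does not change the Hamiltonian count).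

Edge case made explicit by the formalisation: for `N = 1` (`D = []`, `s = t = 0`) the
Hamiltonian path `[0]` exists but `E₀ = []` has no walk at all (`GridSAW.IsSAWIn` asks the points
to be vertices of the edge list), so the identity needs `N ≥ 2`; the reduction of (T3) must send
one-vertex instances to a fixed instance with exactly one walk. In the source `G′ = G + s′ + t′`
always has at least three nodes. The grid plays no role in (T2) beyond the types: only the
combinatorics of the drawing is used.

## References

* M. Liśkiewicz, M. Ogihara, S. Toda, *The complexity of counting self-avoiding walks in
  subgraphs of two-dimensional grids and hypercubes*, TCS 304 (2003) 129–156, §4, proof of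
  Theorem 7 (E₀–E₂, `h = L²(N+1)`, the two sentences quoted above), §2.3 (`#HamPath`).
-/

namespace Literature.Barriers.CriticalPhenomena.GridSAW

/-! ### Generic list facts -/

/-- From a pairwise relation on a list, two distinct members are related one way or the other.
[folklore] -/
theorem pairwise_mem_mem {α : Type*} {R : α → α → Prop} :
    ∀ {l : List α}, l.Pairwise R → ∀ {a b : α}, a ∈ l → b ∈ l → a ≠ b → R a b ∨ R b a
  | [], _, a, b, ha, _, _ => by simp at ha
  | x :: l, h, a, b, ha, hb, hab => by
    rw [List.pairwise_cons] at h
    simp only [List.mem_cons] at ha hb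
    rcases ha with rfl | ha
    · rcases hb with rfl | hb
      · exact (hab rfl).elim
      · exact Or.inl (h.1 b hb)
    · rcases hb with rfl | hb
      · exact Or.inr (h.1 a ha)
      · exact pairwise_mem_mem h.2 ha hb hab

/-- Membership in `pathEdges` by position: `(x, y)` is a consecutive pair of `l`. [folklore] -/
theorem mem_pathEdges_iff : ∀ {l : List GridPoint} {x y : GridPoint},
    (x, y) ∈ pathEdges l ↔ ∃ i : ℕ, ∃ h : i + 1 < l.length,
      l[i]'(Nat.lt_of_succ_lt h) = x ∧ l[i + 1] = y
  | [], x, y => by simp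
  | [p], x, y => by simp
  | p :: q :: l, x, y => by
    rw [pathEdges_cons_cons, List.mem_cons, mem_pathEdges_iff]
    constructor
    · rintro (h | ⟨i, hi, hx, hy⟩)
      · simp only [Prod.mk.injEq] at h
        exact ⟨0, by simp, by simp [h.1], by simp [h.2]⟩
      · exact ⟨i + 1, by simpa using hi, by simpa using hx, by simpa using hy⟩
    · rintro ⟨i, hi, hx, hy⟩
      cases i with
      | zero =>
        left
        simp only [List.getElem_cons_zero, zero_add, List.getElem_cons_succ] at hx hy
        rw [hx, hy]
      | succ i =>
        right
        refine ⟨i, by simpa using hi, ?_, ?_⟩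
        · simpa using hx
        · simpa using hy

/-- Symmetric adjacency along a point list: consecutive in either order. [folklore] -/
def ListAdj (l : List GridPoint) (x y : GridPoint) : Prop :=
  (x, y) ∈ pathEdges l ∨ (y, x) ∈ pathEdges l

/-- `ListAdj` is symmetric. [folklore] -/
theorem ListAdj.symm {l : List GridPoint} {x y : GridPoint} (h : ListAdj l x y) : ListAdj l y x :=
  Or.symm h

/-- The consecutive pairs of a reversed list are the reversed consecutive pairs. [folklore] -/
theorem mem_pathEdges_reverse {l : List GridPoint} {x y : GridPoint} :
    (x, y) ∈ pathEdges l.reverse ↔ (y, x) ∈ pathEdges l := by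
  rw [mem_pathEdges_iff, mem_pathEdges_iff]
  constructor
  · rintro ⟨i, hi, hx, hy⟩
    rw [List.length_reverse] at hi
    refine ⟨l.length - 1 - (i + 1), by omega, ?_, ?_⟩
    · rw [← hy, List.getElem_reverse]
    · rw [← hx, List.getElem_reverse]
      congr 1
      omega
  · rintro ⟨i, hi, hy, hx⟩
    refine ⟨l.length - 1 - (i + 1), by rw [List.length_reverse]; omega, ?_, ?_⟩
    · rw [List.getElem_reverse, ← hx]
      congr 1
      omega
    · rw [List.getElem_reverse, ← hy]
      congr 1
      omega

/-- Adjacency along a list is invariant under reversal. [folklore] -/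
theorem listAdj_reverse {l : List GridPoint} {x y : GridPoint} :
    ListAdj l.reverse x y ↔ ListAdj l x y := by
  unfold ListAdj
  rw [mem_pathEdges_reverse, mem_pathEdges_reverse, or_comm]

/-- In a list without repetitions, the neighbours of the `k`-th entry are the `(k+1)`-st and the
`(k-1)`-st entries. [folklore] -/
theorem ListAdj.eq_getElem_of_nodup {l : List GridPoint} (hl : l.Nodup) {k : ℕ} (hk : k < l.length)
    {y : GridPoint} (h : ListAdj l l[k] y) :
    (∃ h' : k + 1 < l.length, y = l[k + 1]) ∨ (∃ h' : 0 < k, y = l[k - 1]'(by omega)) := by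
  rcases h with h | h
  · obtain ⟨i, hi, hx, hy⟩ := mem_pathEdges_iff.mp h
    have hik : i = k := (hl.getElem_inj_iff).mp hx
    subst hik
    exact Or.inl ⟨hi, hy.symm⟩
  · obtain ⟨i, hi, hy, hx⟩ := mem_pathEdges_iff.mp h
    have hik : i + 1 = k := (hl.getElem_inj_iff).mp hx
    subst hik
    exact Or.inr ⟨Nat.succ_pos i, by simpa using hy.symm⟩

/-- Adjacency in `E₀ = drawnEdges D` is adjacency along one of the drawn paths. [folklore] -/
theorem adj_drawnEdges_iff {D : List DrawnEdge} {x y : GridPoint} :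
    Adj (drawnEdges D) x y ↔ ∃ e ∈ D, ListAdj e.2.2 x y := by
  simp only [Adj, drawnEdges, List.mem_flatMap, ListAdj]
  constructor
  · rintro (⟨e, he, h⟩ | ⟨e, he, h⟩)
    · exact ⟨e, he, Or.inl h⟩
    · exact ⟨e, he, Or.inr h⟩
  · rintro ⟨e, he, h | h⟩
    · exact Or.inl ⟨e, he, h⟩
    · exact Or.inr ⟨e, he, h⟩


/-! ### Ends, orientation and interior of a drawn edge -/

/-- The drawn edge `e` joins the abstract vertices `a` and `b` (in either order).
[cite: LiskiewiczOgiharaToda2003, §2.3] -/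
def HasEnds (e : DrawnEdge) (a b : ℕ) : Prop :=
  (e.1 = a ∧ e.2.1 = b) ∨ (e.1 = b ∧ e.2.1 = a)

/-- Decidability of `HasEnds`. [folklore] -/
instance (e : DrawnEdge) (a b : ℕ) : Decidable (HasEnds e a b) := by
  unfold HasEnds; infer_instance

/-- `DAdj D a b` unfolds to: some drawn edge has ends `{a, b}`. [folklore] -/
theorem dAdj_iff {D : List DrawnEdge} {a b : ℕ} : DAdj D a b ↔ ∃ e ∈ D, HasEnds e a b := Iff.rfl

/-- `HasEnds` is symmetric in the two vertices. [folklore] -/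
theorem HasEnds.symm {e : DrawnEdge} {a b : ℕ} (h : HasEnds e a b) : HasEnds e b a := by
  unfold HasEnds at *; tauto

/-- Two edges with the same end pair have the `SameEnds` relation. [folklore] -/
theorem HasEnds.sameEnds {e e' : DrawnEdge} {a b : ℕ} (h : HasEnds e a b) (h' : HasEnds e' a b) :
    SameEnds e e' := by
  unfold HasEnds SameEnds at *; omega

/-- The end pair of an edge is determined: `HasEnds e a b` and `HasEnds e u w` force
`{a, b} = {u, w}`. [folklore] -/
theorem HasEnds.mem_of_hasEnds {e : DrawnEdge} {a b u w : ℕ} (h : HasEnds e a b) (h' : HasEnds e u w) :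
    a = u ∨ a = w := by
  unfold HasEnds at *; omega

/-- An edge with ends `{a, b}` has `a` as one of its ends. [folklore] -/
theorem HasEnds.fst_or_snd {e : DrawnEdge} {a b : ℕ} (h : HasEnds e a b) : e.1 = a ∨ e.2.1 = a := by
  unfold HasEnds at h; omega

/-- In a drawing, an edge with given ends is unique. [folklore] -/
theorem IsGridDrawing.eq_of_hasEnds {P : List GridPoint} {D : List DrawnEdge} (hD : IsGridDrawing P D)
    {e e' : DrawnEdge} (he : e ∈ D) (he' : e' ∈ D) {a b : ℕ} (h : HasEnds e a b)
    (h' : HasEnds e' a b) : e = e' := by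
  by_contra hne
  rcases pairwise_mem_mem hD.2.2.1 he he' hne with hs | hs
  · exact hs (h.sameEnds h')
  · exact hs (h'.sameEnds h)

/-- In a drawing, a point common to two distinct drawn edges is a vertex image. [folklore] -/
theorem IsGridDrawing.mem_of_mem_mem {P : List GridPoint} {D : List DrawnEdge}
    (hD : IsGridDrawing P D) {e e' : DrawnEdge} (he : e ∈ D) (he' : e' ∈ D) (hne : e ≠ e')
    {x : GridPoint} (hx : x ∈ e.2.2) (hx' : x ∈ e'.2.2) : x ∈ P := by
  rcases pairwise_mem_mem hD.2.2.2.1 he he' hne with h | h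
  · exact h x hx hx'
  · exact h x hx' hx

/-- The other end of `e`, seen from the end `a`. [folklore] -/
def otherEnd (e : DrawnEdge) (a : ℕ) : ℕ := if e.1 = a then e.2.1 else e.1

/-- The realising path of `e` oriented so as to start at the image of its end `a`.
[cite: LiskiewiczOgiharaToda2003, §4 (proof of Theorem 7: "the path realizing e")] -/
def orientedPath (e : DrawnEdge) (a : ℕ) : List GridPoint :=
  if e.1 = a then e.2.2 else e.2.2.reverse

/-- `e` has ends `a` and `otherEnd e a` when `a` is an end of `e`. [folklore] -/
theorem hasEnds_otherEnd {e : DrawnEdge} {a : ℕ} (ha : e.1 = a ∨ e.2.1 = a) :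
    HasEnds e a (otherEnd e a) := by
  unfold HasEnds otherEnd; split_ifs <;> omega

/-- The oriented path has the same members as the path. [folklore] -/
@[simp] theorem mem_orientedPath {e : DrawnEdge} {a : ℕ} {x : GridPoint} :
    x ∈ orientedPath e a ↔ x ∈ e.2.2 := by
  unfold orientedPath; split_ifs <;> simp

/-- The oriented path has the same length as the path. [folklore] -/
@[simp] theorem length_orientedPath (e : DrawnEdge) (a : ℕ) :
    (orientedPath e a).length = e.2.2.length := by
  unfold orientedPath; split_ifs <;> simp

/-- Adjacency along the oriented path is adjacency along the path. [folklore] -/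
theorem listAdj_orientedPath {e : DrawnEdge} {a : ℕ} {x y : GridPoint} :
    ListAdj (orientedPath e a) x y ↔ ListAdj e.2.2 x y := by
  unfold orientedPath; split_ifs
  · rfl
  · exact listAdj_reverse

section Drawing

variable {P : List GridPoint} {D : List DrawnEdge}

/-- The oriented path of a drawn edge has no repeated point. [folklore] -/
theorem nodup_orientedPath (hD : IsGridDrawing P D) {e : DrawnEdge} (he : e ∈ D) (a : ℕ) :
    (orientedPath e a).Nodup := by
  have h := (hD.2.1 e he).2.2.2.2.2.1
  unfold orientedPath; split_ifs
  · exact h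
  · exact List.nodup_reverse.mpr h

/-- The oriented path of a drawn edge has at least two points. [folklore] -/
theorem two_le_length_orientedPath (hD : IsGridDrawing P D) {e : DrawnEdge} (he : e ∈ D) (a : ℕ) :
    2 ≤ (orientedPath e a).length := by
  rw [length_orientedPath]
  exact two_le_length_of_isDrawnEdgeOf hD.1 (hD.2.1 e he)

/-- An end of a drawn edge is a vertex (index below `P.length`). [folklore] -/
theorem lt_length_of_isEnd (hD : IsGridDrawing P D) {e : DrawnEdge} (he : e ∈ D) {a : ℕ}
    (ha : e.1 = a ∨ e.2.1 = a) : a < P.length := by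
  have h := hD.2.1 e he
  rcases ha with rfl | rfl
  · exact h.1
  · exact h.2.1

/-- The other end is a vertex. [folklore] -/
theorem otherEnd_lt_length (hD : IsGridDrawing P D) {e : DrawnEdge} (he : e ∈ D) (a : ℕ) :
    otherEnd e a < P.length := by
  have h := hD.2.1 e he
  unfold otherEnd; split_ifs
  · exact h.2.1
  · exact h.1

/-- The other end differs from the given vertex (the two ends of a drawn edge are distinct).
[folklore] -/
theorem otherEnd_ne (hD : IsGridDrawing P D) {e : DrawnEdge} (he : e ∈ D) (a : ℕ) :
    otherEnd e a ≠ a := by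
  have h := (hD.2.1 e he).2.2.1
  unfold otherEnd; split_ifs <;> omega

/-- The oriented path starts at the image of `a`. [folklore] -/
theorem head?_orientedPath (hD : IsGridDrawing P D) {e : DrawnEdge} (he : e ∈ D) {a : ℕ}
    (ha : e.1 = a ∨ e.2.1 = a) : (orientedPath e a).head? = P[a]? := by
  obtain ⟨-, -, -, hhead, hlast, -⟩ := hD.2.1 e he
  unfold orientedPath; split_ifs with h1
  · rw [hhead, h1]
  · rw [List.head?_reverse, hlast, ha.resolve_left h1]

/-- The oriented path ends at the image of the other end. [folklore] -/
theorem getLast?_orientedPath (hD : IsGridDrawing P D) {e : DrawnEdge} (he : e ∈ D) (a : ℕ) :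
    (orientedPath e a).getLast? = P[otherEnd e a]? := by
  obtain ⟨-, -, -, hhead, hlast, -⟩ := hD.2.1 e he
  unfold orientedPath otherEnd; split_ifs with h1
  · rw [hlast]
  · rw [List.getLast?_reverse, hhead]

/-- A point of a drawn edge that is a vertex image is the image of one of its two ends.
[folklore] -/
theorem isEnd_of_mem_of_getElem? (hD : IsGridDrawing P D) {e : DrawnEdge} (he : e ∈ D)
    {x : GridPoint} (hx : x ∈ e.2.2) {v : ℕ} (hPv : P[v]? = some x) :
    e.1 = v ∨ e.2.1 = v := by
  obtain ⟨h1, h2, -, -, -, -, -, hint⟩ := hD.2.1 e he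
  have hxP : x ∈ P := List.mem_iff_getElem?.mpr ⟨v, hPv⟩
  rcases hint x hx hxP with h | h
  · left
    exact (List.getElem?_inj h1 hD.1).mp (h.trans hPv.symm)
  · right
    exact (List.getElem?_inj h2 hD.1).mp (h.trans hPv.symm)

/-- **Interior points of a drawn edge are not vertex images** (indices strictly between the
ends of the oriented path). [cite: LiskiewiczOgiharaToda2003, §4 (proof of Theorem 7: embedding without vertex congestion)] -/
theorem getElem_orientedPath_not_mem (hD : IsGridDrawing P D) {e : DrawnEdge} (he : e ∈ D)
    (a : ℕ) {k : ℕ} (hk0 : 0 < k) (hk : k + 1 < (orientedPath e a).length) :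
    (orientedPath e a)[k]'(Nat.lt_of_succ_lt hk) ∉ P := by
  intro hP
  set π := orientedPath e a with hπ
  have hnd : π.Nodup := nodup_orientedPath hD he a
  obtain ⟨h1, h2, -, hhead, hlast, -, -, hint⟩ := hD.2.1 e he
  have hx : π[k] ∈ e.2.2 := mem_orientedPath.mp (List.getElem_mem _)
  -- the head and the last entry of `π` are the two end images, in some order
  have hends : (P[e.1]? = π.head? ∧ P[e.2.1]? = π.getLast?) ∨
      (P[e.1]? = π.getLast? ∧ P[e.2.1]? = π.head?) := by
    rw [hπ]
    unfold orientedPath; split_ifs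
    · exact Or.inl ⟨hhead.symm, hlast.symm⟩
    · exact Or.inr ⟨by rw [List.getLast?_reverse, hhead], by rw [List.head?_reverse, hlast]⟩
  have hhead' : π.head? = some π[0] := by
    rw [List.head?_eq_getElem?]; exact List.getElem?_eq_getElem (by omega)
  have hlast' : π.getLast? = some (π[π.length - 1]'(by omega)) := by
    rw [List.getLast?_eq_getElem?]; exact List.getElem?_eq_getElem (by omega)
  have key : P[e.1]? = some π[k] ∨ P[e.2.1]? = some π[k] := hint _ hx hP
  have h0 : π[k] ≠ π[0] := fun h => by
    have := (hnd.getElem_inj_iff).mp h; omega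
  have hL : π[k] ≠ π[π.length - 1]'(by omega) := fun h => by
    have := (hnd.getElem_inj_iff).mp h; omega
  rcases hends with ⟨he1, he2⟩ | ⟨he1, he2⟩ <;> rcases key with hk' | hk'
  · exact h0 (Option.some.inj ((hk'.symm.trans he1).trans hhead')).symm.symm
  · exact hL (Option.some.inj ((hk'.symm.trans he2).trans hlast'))
  · exact hL (Option.some.inj ((hk'.symm.trans he1).trans hlast'))
  · exact h0 (Option.some.inj ((hk'.symm.trans he2).trans hhead'))

/-! ### A self-avoiding walk that enters a drawn edge follows it -/

/-- Both members of an adjacent pair along `l` belong to `l`. [folklore] -/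
theorem ListAdj.mem_left {l : List GridPoint} {x y : GridPoint} (h : ListAdj l x y) : x ∈ l := by
  rcases h with h | h
  · exact (mem_of_mem_pathEdges h).1
  · exact (mem_of_mem_pathEdges h).2

/-- Consecutive entries of a list are adjacent along it. [folklore] -/
theorem listAdj_getElem_succ {l : List GridPoint} {k : ℕ} (hk : k + 1 < l.length) :
    ListAdj l (l[k]'(Nat.lt_of_succ_lt hk)) l[k + 1] :=
  Or.inl (mem_pathEdges_iff.mpr ⟨k, hk, rfl, rfl⟩)

/-- **A walk that enters a drawn edge follows it.** Let `ω` be a self-avoiding chain of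
`E₀ = drawnEdges D` whose first two points are the first two points of the oriented path `π` of
a drawn edge `e`. Then `ω` and `π` agree on all common indices: the interior points of `π` have
degree two in `E₀` (no other drawn edge passes through them), and self-avoidance forbids turning
back. [cite: LiskiewiczOgiharaToda2003, §4 (proof of Theorem 7: "every path in E₂ having length h corresponds to a Hamiltonian path")] -/
theorem getElem_eq_orientedPath (hD : IsGridDrawing P D) {e : DrawnEdge} (he : e ∈ D) (a : ℕ)
    {ω : List GridPoint} (hω : List.IsChain (Adj (drawnEdges D)) ω) (hnd : ω.Nodup)
    (h2 : 2 ≤ ω.length)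
    (h0 : ω[0]'(by omega) = (orientedPath e a)[0]'(by
      have := two_le_length_orientedPath hD he a; omega))
    (h1 : ω[1]'(by omega) = (orientedPath e a)[1]'(by
      have := two_le_length_orientedPath hD he a; omega)) :
    ∀ (k : ℕ) (hk : k < ω.length) (hk' : k < (orientedPath e a).length),
      ω[k] = (orientedPath e a)[k] := by
  set π := orientedPath e a with hπ
  have hπnd : π.Nodup := nodup_orientedPath hD he a
  intro k
  induction k using Nat.strong_induction_on with
  | _ k ih =>
    intro hk hk'
    match k with
    | 0 => exact h0
    | 1 => exact h1
    | k + 2 =>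
      have e1 : ω[k + 1] = π[k + 1] := ih (k + 1) (by omega) (by omega) (by omega)
      have e0 : ω[k]'(by omega) = π[k]'(by omega) := ih k (by omega) (by omega) (by omega)
      have hadj : Adj (drawnEdges D) ω[k + 1] ω[k + 2] :=
        List.isChain_iff_getElem.mp hω (k + 1) (by omega)
      obtain ⟨e', he', hadj'⟩ := adj_drawnEdges_iff.mp hadj
      by_cases hee : e' = e
      · subst hee
        rw [e1, ← listAdj_orientedPath (a := a)] at hadj'
        rcases hadj'.eq_getElem_of_nodup hπnd (by omega) with ⟨_, h⟩ | ⟨_, h⟩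
        · exact h
        · exfalso
          have h' : ω[k + 2] = ω[k]'(by omega) := by
            rw [h, e0]
            simp only [Nat.add_sub_cancel]
          have := (hnd.getElem_inj_iff).mp h'
          omega
      · exfalso
        have hx' : ω[k + 1] ∈ e'.2.2 := hadj'.mem_left
        have hx : ω[k + 1] ∈ e.2.2 := by
          rw [e1]; exact mem_orientedPath.mp (List.getElem_mem _)
        have hP : π[k + 1] ∈ P := e1 ▸ hD.mem_of_mem_mem he he' (Ne.symm hee) hx hx'
        exact getElem_orientedPath_not_mem hD he a (Nat.succ_pos k) (by omega) hP

/-- Consequence: if `ω` is not longer than `π`, it is a prefix of `π`. [folklore] -/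
theorem prefix_orientedPath_of_length_le (hD : IsGridDrawing P D) {e : DrawnEdge} (he : e ∈ D)
    (a : ℕ) {ω : List GridPoint} (hω : List.IsChain (Adj (drawnEdges D)) ω) (hnd : ω.Nodup)
    (h2 : 2 ≤ ω.length)
    (h0 : ω[0]'(by omega) = (orientedPath e a)[0]'(by
      have := two_le_length_orientedPath hD he a; omega))
    (h1 : ω[1]'(by omega) = (orientedPath e a)[1]'(by
      have := two_le_length_orientedPath hD he a; omega))
    (hle : ω.length ≤ (orientedPath e a).length) :
    ω = (orientedPath e a).take ω.length := by
  refine List.ext_getElem (by rw [List.length_take]; omega) fun k hk hk' => ?_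
  rw [List.getElem_take]
  exact getElem_eq_orientedPath hD he a hω hnd h2 h0 h1 k hk (by omega)

/-- Consequence: if `ω` is at least as long as `π`, then `π` is a prefix of `ω`. [folklore] -/
theorem orientedPath_eq_take_of_length_le (hD : IsGridDrawing P D) {e : DrawnEdge} (he : e ∈ D)
    (a : ℕ) {ω : List GridPoint} (hω : List.IsChain (Adj (drawnEdges D)) ω) (hnd : ω.Nodup)
    (h2 : 2 ≤ ω.length)
    (h0 : ω[0]'(by omega) = (orientedPath e a)[0]'(by
      have := two_le_length_orientedPath hD he a; omega))
    (h1 : ω[1]'(by omega) = (orientedPath e a)[1]'(by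
      have := two_le_length_orientedPath hD he a; omega))
    (hle : (orientedPath e a).length ≤ ω.length) :
    orientedPath e a = ω.take (orientedPath e a).length := by
  refine List.ext_getElem (by rw [List.length_take]; omega) fun k hk hk' => ?_
  rw [List.getElem_take]
  exact (getElem_eq_orientedPath hD he a hω hnd h2 h0 h1 k (by omega) hk).symm

/-- **The first step of a walk from a vertex image picks a drawn edge.** If a self-avoiding
chain of `E₀` starts at the image of the vertex `a` and has a second point, then its first two
points are the first two points of the oriented path of a drawn edge at `a`.
[cite: LiskiewiczOgiharaToda2003, §4 (proof of Theorem 7)] -/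
theorem exists_edge_of_getElem_zero (hD : IsGridDrawing P D) {a : ℕ} (ha : a < P.length)
    {ω : List GridPoint} (hω : List.IsChain (Adj (drawnEdges D)) ω) (h2 : 2 ≤ ω.length)
    (h0 : ω[0]'(by omega) = P[a]) :
    ∃ e ∈ D, (e.1 = a ∨ e.2.1 = a) ∧
      ∃ h : 2 ≤ (orientedPath e a).length,
        ω[0]'(by omega) = (orientedPath e a)[0]'(by omega) ∧
        ω[1]'(by omega) = (orientedPath e a)[1]'(by omega) := by
  have hadj : Adj (drawnEdges D) (ω[0]'(by omega)) (ω[1]'(by omega)) :=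
    List.isChain_iff_getElem.mp hω 0 (by omega)
  obtain ⟨e, he, hadj'⟩ := adj_drawnEdges_iff.mp hadj
  have hea : e.1 = a ∨ e.2.1 = a :=
    isEnd_of_mem_of_getElem? hD he hadj'.mem_left (by rw [List.getElem?_eq_getElem ha, h0])
  have hlen := two_le_length_orientedPath hD he a
  have hπ0 : (orientedPath e a)[0]'(by omega) = ω[0]'(by omega) := by
    have h := head?_orientedPath hD he hea
    rw [List.head?_eq_getElem?, List.getElem?_eq_getElem (by omega),
      List.getElem?_eq_getElem ha, Option.some.injEq] at h
    rw [h, h0]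
  refine ⟨e, he, hea, hlen, hπ0.symm, ?_⟩
  rw [← listAdj_orientedPath (a := a), ← hπ0] at hadj'
  rcases hadj'.eq_getElem_of_nodup (nodup_orientedPath hD he a) (by omega) with ⟨_, h⟩ | ⟨h, _⟩
  · exact h
  · exact absurd h (lt_irrefl 0)

/-! ### Abstract paths and their realisations -/

/-- An **abstract simple path** of the drawn graph on the vertices `0, …, N-1`: pairwise
distinct vertices, consecutive ones adjacent. [cite: LiskiewiczOgiharaToda2003, §2.3] -/
def IsAbsPath (N : ℕ) (D : List DrawnEdge) (l : List ℕ) : Prop :=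
  l.Nodup ∧ (∀ v ∈ l, v < N) ∧ List.IsChain (DAdj D) l

/-- The image of the vertex `v` (junk value `gridOrigin` out of range). [folklore] -/
def img (P : List GridPoint) (v : ℕ) : GridPoint := (P[v]?).getD gridOrigin

/-- In range, `img P v = P[v]`. [folklore] -/
theorem img_eq_getElem {P : List GridPoint} {v : ℕ} (hv : v < P.length) : img P v = P[v] := by
  simp [img, List.getElem?_eq_getElem hv]

/-- In range, `P[v]? = some (img P v)`. [folklore] -/
theorem getElem?_eq_some_img {P : List GridPoint} {v : ℕ} (hv : v < P.length) :
    P[v]? = some (img P v) := by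
  rw [img_eq_getElem hv, List.getElem?_eq_getElem hv]

/-- The (first) drawn edge with ends `{a, b}`. [folklore] -/
def findEdge (D : List DrawnEdge) (a b : ℕ) : Option DrawnEdge :=
  D.find? fun e => decide (HasEnds e a b)

/-- The **segment** contributed by the abstract step `a → b`: the oriented path of the edge
`{a, b}` without its first point (empty if there is no such edge). [folklore] -/
def segment (D : List DrawnEdge) (a b : ℕ) : List GridPoint :=
  match findEdge D a b with
  | some e => (orientedPath e a).tail
  | none => []

/-- The points after the first one of the realisation of an abstract vertex list starting at
`a`. [folklore] -/
def realizeTail (D : List DrawnEdge) : ℕ → List ℕ → List GridPoint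
  | _, [] => []
  | a, b :: l => segment D a b ++ realizeTail D b l

/-- **The realisation of an abstract vertex list**: the image of its first vertex followed by
the segments of its steps — for an abstract path, the grid walk "realizing" it.
[cite: LiskiewiczOgiharaToda2003, §4 (proof of Theorem 7: "every Hamiltonian path of G′ is realized by a path in E₂")] -/
def realize (P : List GridPoint) (D : List DrawnEdge) : List ℕ → List GridPoint
  | [] => []
  | a :: l => img P a :: realizeTail D a l

/-- In a drawing, `findEdge` finds the edge with the given ends. [folklore] -/
theorem findEdge_eq (hD : IsGridDrawing P D) {e : DrawnEdge} (he : e ∈ D) {a b : ℕ}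
    (h : HasEnds e a b) : findEdge D a b = some e := by
  have hsome : (findEdge D a b).isSome := List.find?_isSome.mpr ⟨e, he, by simpa using h⟩
  obtain ⟨e', he'⟩ := Option.isSome_iff_exists.mp hsome
  have h' : HasEnds e' a b := by simpa using List.find?_some he'
  rw [hD.eq_of_hasEnds he (List.mem_of_find?_eq_some he') h h']
  exact he'

/-- In a drawing, the segment of a step is the tail of the oriented path of its edge.
[folklore] -/
theorem segment_eq (hD : IsGridDrawing P D) {e : DrawnEdge} (he : e ∈ D) {a b : ℕ}
    (h : HasEnds e a b) : segment D a b = (orientedPath e a).tail := by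
  unfold segment
  rw [findEdge_eq hD he h]

/-- The other end of an edge with ends `{a, b}`, seen from `a`, is `b`. [folklore] -/
theorem HasEnds.otherEnd_eq {e : DrawnEdge} {a b : ℕ} (h : HasEnds e a b) (hne : e.1 ≠ e.2.1) :
    otherEnd e a = b := by
  unfold HasEnds at h; unfold otherEnd; split_ifs <;> omega

/-- **Unfolding the realisation along its first step**: for the drawn edge `e = {a, b}`,
`realize (a :: b :: l) = π.dropLast ++ realize (b :: l)` with `π` the path of `e` oriented from
the image of `a` to the image of `b`. [folklore] -/
theorem realize_cons_cons (hD : IsGridDrawing P D) {e : DrawnEdge} (he : e ∈ D) {a b : ℕ}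
    (h : HasEnds e a b) (l : List ℕ) :
    realize P D (a :: b :: l) = (orientedPath e a).dropLast ++ realize P D (b :: l) := by
  have ha : a < P.length := lt_length_of_isEnd hD he h.fst_or_snd
  have hb' : otherEnd e a = b := h.otherEnd_eq (hD.2.1 e he).2.2.1
  have hb : b < P.length := hb' ▸ otherEnd_lt_length hD he a
  have hhead : orientedPath e a = img P a :: (orientedPath e a).tail :=
    List.eq_cons_of_mem_head? (by
      rw [head?_orientedPath hD he h.fst_or_snd, getElem?_eq_some_img ha]; exact rfl)
  have hlast : (orientedPath e a).dropLast ++ [img P b] = orientedPath e a :=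
    List.dropLast_append_getLast? _ (by
      rw [getLast?_orientedPath hD he a, hb', getElem?_eq_some_img hb]; exact rfl)
  show img P a :: (segment D a b ++ realizeTail D b l) = _ ++ img P b :: realizeTail D b l
  rw [segment_eq hD he h, ← List.cons_append, ← hhead]
  conv_lhs => rw [← hlast]
  simp

/-- In a list without repetitions the first entry does not recur later. [folklore] -/
theorem getElem_zero_not_mem_drop {α : Type*} {l : List α} (hl : l.Nodup) (h0 : 0 < l.length)
    {m : ℕ} (hm : 0 < m) : l[0] ∉ l.drop m := by
  intro h
  obtain ⟨i, hi, heq⟩ := List.mem_iff_getElem.mp h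
  rw [List.getElem_drop] at heq
  have := (hl.getElem_inj_iff).mp heq
  omega

/-- Every vertex of an abstract chain has its image on the realisation. [folklore] -/
theorem img_mem_realize (hD : IsGridDrawing P D) :
    ∀ {a : ℕ} {l : List ℕ}, List.IsChain (DAdj D) (a :: l) →
      ∀ v ∈ a :: l, img P v ∈ realize P D (a :: l)
  | a, [], _, v, hv => by
    simp only [List.mem_singleton] at hv
    subst hv
    simp [realize]
  | a, b :: l, hch, v, hv => by
    obtain ⟨e, he, (hab : HasEnds e a b)⟩ := (List.isChain_cons_cons.mp hch).1
    rcases List.mem_cons.mp hv with rfl | hv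
    · exact List.mem_cons_self
    · rw [realize_cons_cons hD he hab]
      exact List.mem_append_right _ (img_mem_realize hD (List.isChain_cons_cons.mp hch).2 v hv)

/-! ### Decomposition: every walk between vertex images realises an abstract path -/

/-- **Decomposition of walks of `E₀`.** A self-avoiding chain of `E₀ = drawnEdges D` from the
image of a vertex `a` to the image of some vertex is the realisation of an abstract simple path
starting at `a` (by induction on the length: the walk follows the drawn edge it enters up to the
next vertex image, `getElem_eq_orientedPath`, and cannot stop inside an edge because interior
points are not vertex images). [cite: LiskiewiczOgiharaToda2003, §4 (proof of Theorem 7: "every path in E₂ having length h corresponds to a Hamiltonian path in G′")] -/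
theorem exists_absPath_realize_eq (hD : IsGridDrawing P D) (n : ℕ) :
    ∀ {ω : List GridPoint} {a : ℕ} (_ : ω.length = n) (_ : List.IsChain (Adj (drawnEdges D)) ω)
      (_ : ω.Nodup) (ha : a < P.length) (_ : ω.head? = some P[a])
      (_ : ∃ c, ∃ hc : c < P.length, ω.getLast? = some P[c]),
      ∃ l : List ℕ, IsAbsPath P.length D (a :: l) ∧ realize P D (a :: l) = ω := by
  induction n using Nat.strong_induction_on with
  | _ n ih =>
    intro ω a hlen hω hnd ha hhead hlast
    match n, ω, hlen with
    | 0, [], _ => simp at hhead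
    | 1, [p], _ =>
      refine ⟨[], ⟨List.nodup_singleton a, by simpa using ha, List.IsChain.singleton a⟩, ?_⟩
      simp only [List.head?_cons, Option.some.injEq] at hhead
      simp [realize, realizeTail, img_eq_getElem ha, hhead]
    | n + 2, ω, hlen =>
      have h0 : ω[0]'(by omega) = P[a] := by
        rw [List.head?_eq_getElem?, List.getElem?_eq_getElem (by omega), Option.some.injEq] at hhead
        exact hhead
      obtain ⟨e, he, hea, hπlen, hω0, hω1⟩ := exists_edge_of_getElem_zero hD ha hω (by omega) h0
      have hab : HasEnds e a (otherEnd e a) := hasEnds_otherEnd hea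
      have hblt : otherEnd e a < P.length := otherEnd_lt_length hD he a
      have hπlast : (orientedPath e a).getLast? = some P[otherEnd e a] := by
        rw [getLast?_orientedPath hD he a, List.getElem?_eq_getElem hblt]
      by_cases hcase : ω.length < (orientedPath e a).length
      · -- `ω` stops inside the edge: its last point is interior, not a vertex image
        exfalso
        obtain ⟨c, hc, hωlast⟩ := hlast
        have hlast' : ω.getLast? = some ((orientedPath e a)[ω.length - 1]'(by omega)) := by
          rw [List.getLast?_eq_getElem?, List.getElem?_eq_getElem (by omega), Option.some.injEq,
            getElem_eq_orientedPath hD he a hω hnd (by omega) hω0 hω1 _ (by omega) (by omega)]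
        have hP : (orientedPath e a)[ω.length - 1]'(by omega) ∈ P := by
          rw [hlast', Option.some.injEq] at hωlast
          rw [hωlast]; exact List.getElem_mem hc
        exact getElem_orientedPath_not_mem hD he a (k := ω.length - 1) (by omega) (by omega) hP
      · -- the oriented path is a prefix of `ω`: recurse on the rest
        have hle : (orientedPath e a).length ≤ ω.length := not_lt.mp hcase
        have htake : orientedPath e a = ω.take (orientedPath e a).length :=
          orientedPath_eq_take_of_length_le hD he a hω hnd (by omega) hω0 hω1 hle
        -- `m` = number of edges of the oriented path
        obtain ⟨m, hm⟩ : ∃ m, m = (orientedPath e a).length - 1 := ⟨_, rfl⟩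
        have hωm : ω[m]'(by omega) = P[otherEnd e a] := by
          have h1 : ω[m]'(by omega) = (orientedPath e a)[m]'(by omega) :=
            getElem_eq_orientedPath hD he a hω hnd (by omega) hω0 hω1 m (by omega) (by omega)
          rw [List.getLast?_eq_getElem?, List.getElem?_eq_getElem (by omega),
            Option.some.injEq] at hπlast
          rw [h1, ← hπlast]
          congr 1
        obtain ⟨l', hpath, hreal⟩ := ih (n + 2 - m) (by omega) (ω := ω.drop m) (a := otherEnd e a)
          (by rw [List.length_drop]; omega) (hω.drop m) (hnd.sublist (List.drop_sublist m ω)) hblt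
          (by rw [List.head?_drop, List.getElem?_eq_getElem (by omega), hωm])
          (by
            obtain ⟨c, hc, hωlast⟩ := hlast
            exact ⟨c, hc, by rw [List.getLast?_drop, if_neg (by omega), hωlast]⟩)
        refine ⟨otherEnd e a :: l', ⟨?_, ?_, ?_⟩, ?_⟩
        · refine List.nodup_cons.mpr ⟨fun hal => ?_, hpath.1⟩
          -- `a ∈ otherEnd e a :: l'` would put `P[a] = ω[0]` into `realize (…) = ω.drop m`
          have hmem : P[a] ∈ realize P D (otherEnd e a :: l') :=
            img_eq_getElem ha ▸ img_mem_realize hD hpath.2.2 a hal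
          rw [hreal] at hmem
          exact getElem_zero_not_mem_drop hnd (by omega) (by omega) (h0 ▸ hmem)
        · intro v hv
          rcases List.mem_cons.mp hv with rfl | hv
          · exact ha
          · exact hpath.2.1 v hv
        · exact List.IsChain.cons hpath.2.2 (by
            simp only [List.head?_cons, Option.mem_def, Option.some.injEq, forall_eq']
            exact ⟨e, he, hab⟩)
        · have hdl : (orientedPath e a).dropLast = ω.take m := by
            conv_lhs => rw [htake]
            rw [List.dropLast_eq_take, List.take_take, List.length_take]
            congr 1
            omega
          rw [realize_cons_cons hD he hab, hreal, hdl, List.take_append_drop]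

/-! ### Realisations of abstract paths are self-avoiding walks -/

/-- The oriented path is the image of its start followed by its tail. [folklore] -/
theorem orientedPath_eq_cons (hD : IsGridDrawing P D) {e : DrawnEdge} (he : e ∈ D) {a : ℕ}
    (ha : e.1 = a ∨ e.2.1 = a) : orientedPath e a = img P a :: (orientedPath e a).tail :=
  List.eq_cons_of_mem_head? (by
    rw [head?_orientedPath hD he ha, getElem?_eq_some_img (lt_length_of_isEnd hD he ha)]; exact rfl)

/-- The oriented path of the edge `{a, b}` is its `dropLast` followed by the image of `b`.
[folklore] -/
theorem dropLast_orientedPath_append (hD : IsGridDrawing P D) {e : DrawnEdge} (he : e ∈ D)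
    {a b : ℕ} (h : HasEnds e a b) :
    (orientedPath e a).dropLast ++ [img P b] = orientedPath e a := by
  have hb' : otherEnd e a = b := h.otherEnd_eq (hD.2.1 e he).2.2.1
  exact List.dropLast_append_getLast? _ (by
    rw [getLast?_orientedPath hD he a, hb', getElem?_eq_some_img (hb' ▸ otherEnd_lt_length hD he a)]
    exact rfl)

/-- The second vertex of an edge `{a, b}` is a vertex. [folklore] -/
theorem HasEnds.lt_length (hD : IsGridDrawing P D) {e : DrawnEdge} (he : e ∈ D) {a b : ℕ}
    (h : HasEnds e a b) : b < P.length :=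
  h.otherEnd_eq (hD.2.1 e he).2.2.1 ▸ otherEnd_lt_length hD he a

/-- The oriented path of a drawn edge is a chain of `E₀`. [folklore] -/
theorem isChain_adj_orientedPath {e : DrawnEdge} (he : e ∈ D) (a : ℕ) :
    List.IsChain (Adj (drawnEdges D)) (orientedPath e a) :=
  List.isChain_iff_getElem.mpr fun _ hi =>
    adj_drawnEdges_iff.mpr ⟨e, he, listAdj_orientedPath.mp (listAdj_getElem_succ hi)⟩

/-- Every point of a drawn edge is a vertex of `E₀`. [folklore] -/
theorem mem_vertexSet_of_mem_path (hD : IsGridDrawing P D) {e : DrawnEdge} (he : e ∈ D)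
    {x : GridPoint} (hx : x ∈ e.2.2) : x ∈ vertexSet (drawnEdges D) :=
  mem_vertexSet_of_pathEdges_subset (pathEdges_subset_drawnEdges he)
    (two_le_length_of_isDrawnEdgeOf hD.1 (hD.2.1 e he)) x hx

/-- Where the later points of a realisation come from: a point of `realizeTail D a l` lies on a
drawn edge whose ends are consecutive vertices of `a :: l`. [folklore] -/
theorem mem_realizeTail : ∀ {a : ℕ} {l : List ℕ} {x : GridPoint}, x ∈ realizeTail D a l →
    ∃ e ∈ D, ∃ u w : ℕ, HasEnds e u w ∧ u ∈ a :: l ∧ w ∈ l ∧ x ∈ e.2.2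
  | a, [], x, h => by simp [realizeTail] at h
  | a, b :: l, x, h => by
    simp only [realizeTail, List.mem_append] at h
    rcases h with h | h
    · unfold segment at h
      split at h
      · rename_i e hfind
        have he : e ∈ D := List.mem_of_find?_eq_some hfind
        have hab : HasEnds e a b := by simpa using List.find?_some hfind
        exact ⟨e, he, a, b, hab, List.mem_cons_self, List.mem_cons_self,
          mem_orientedPath.mp (List.mem_of_mem_tail h)⟩
      · simp at h
    · obtain ⟨e, he, u, w, huw, hu, hw, hx⟩ := mem_realizeTail h
      exact ⟨e, he, u, w, huw, List.mem_cons_of_mem a hu, List.mem_cons_of_mem b hw, hx⟩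

/-- A vertex that is an end of the edge `{u, w}` is `u` or `w`. [folklore] -/
theorem HasEnds.eq_or_eq_of_isEnd {e : DrawnEdge} {u w a : ℕ} (h : HasEnds e u w)
    (ha : e.1 = a ∨ e.2.1 = a) : a = u ∨ a = w := by
  unfold HasEnds at h; omega

/-- The realisation of an abstract chain is a chain of `E₀`. [folklore] -/
theorem isChain_realize (hD : IsGridDrawing P D) :
    ∀ {a : ℕ} {l : List ℕ}, List.IsChain (DAdj D) (a :: l) →
      List.IsChain (Adj (drawnEdges D)) (realize P D (a :: l))
  | a, [], _ => List.IsChain.singleton _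
  | a, b :: l, hch => by
    obtain ⟨e, he, (hab : HasEnds e a b)⟩ := (List.isChain_cons_cons.mp hch).1
    have ih := isChain_realize hD (List.isChain_cons_cons.mp hch).2
    rw [realize_cons_cons hD he hab]
    have h1 : List.IsChain (Adj (drawnEdges D)) ((orientedPath e a).dropLast ++ [img P b]) := by
      rw [dropLast_orientedPath_append hD he hab]; exact isChain_adj_orientedPath he a
    have h := List.IsChain.append_overlap h1 (l₃ := realizeTail D b l) ih (by simp)
    simpa [List.append_assoc, realize] using h

/-- The realisation of an abstract chain ends at the image of its last vertex. [folklore] -/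
theorem getLast?_realize (hD : IsGridDrawing P D) :
    ∀ {a : ℕ} {l : List ℕ}, List.IsChain (DAdj D) (a :: l) →
      (realize P D (a :: l)).getLast? = some (img P ((a :: l).getLast (List.cons_ne_nil a l)))
  | a, [], _ => by simp [realize, realizeTail]
  | a, b :: l, hch => by
    obtain ⟨e, he, (hab : HasEnds e a b)⟩ := (List.isChain_cons_cons.mp hch).1
    rw [realize_cons_cons hD he hab, List.getLast?_append_of_ne_nil _ (by simp [realize]),
      getLast?_realize hD (List.isChain_cons_cons.mp hch).2, List.getLast_cons_cons]

/-- Every point of the realisation of an abstract chain with at least one step lies on a drawn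
edge. [folklore] -/
theorem exists_mem_path_of_mem_realize (hD : IsGridDrawing P D) :
    ∀ {a b : ℕ} {l : List ℕ}, List.IsChain (DAdj D) (a :: b :: l) →
      ∀ x ∈ realize P D (a :: b :: l), ∃ e ∈ D, x ∈ e.2.2
  | a, b, [], hch, x, hx => by
    obtain ⟨e, he, (hab : HasEnds e a b)⟩ := (List.isChain_cons_cons.mp hch).1
    rw [realize_cons_cons hD he hab, show realize P D [b] = [img P b] by simp [realize, realizeTail],
      dropLast_orientedPath_append hD he hab, mem_orientedPath] at hx
    exact ⟨e, he, hx⟩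
  | a, b, c :: l, hch, x, hx => by
    obtain ⟨e, he, (hab : HasEnds e a b)⟩ := (List.isChain_cons_cons.mp hch).1
    rw [realize_cons_cons hD he hab, List.mem_append] at hx
    rcases hx with hx | hx
    · exact ⟨e, he, mem_orientedPath.mp (List.dropLast_subset _ hx)⟩
    · exact exists_mem_path_of_mem_realize hD (List.isChain_cons_cons.mp hch).2 x hx

/-- **The realisation of an abstract simple path is self-avoiding.** The images of distinct
vertices are distinct, interior points of drawn edges are not vertex images, and two distinct
drawn edges share no interior point. [cite: LiskiewiczOgiharaToda2003, §4 (proof of Theorem 7: "every Hamiltonian path of G′ is realized by a path in E₂ of length h")] -/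
theorem nodup_realize (hD : IsGridDrawing P D) :
    ∀ {a : ℕ} {l : List ℕ}, IsAbsPath P.length D (a :: l) → (realize P D (a :: l)).Nodup
  | a, [], _ => List.nodup_singleton _
  | a, b :: l, ⟨hnd, hlt, hch⟩ => by
    obtain ⟨e, he, (hab : HasEnds e a b)⟩ := (List.isChain_cons_cons.mp hch).1
    have hpath' : IsAbsPath P.length D (b :: l) :=
      ⟨hnd.of_cons, fun v hv => hlt v (List.mem_cons_of_mem a hv), (List.isChain_cons_cons.mp hch).2⟩
    have ih := nodup_realize hD hpath'
    have hanot : a ∉ b :: l := (List.nodup_cons.mp hnd).1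
    have hπnd : (orientedPath e a).Nodup := nodup_orientedPath hD he a
    have hsplit := dropLast_orientedPath_append hD he hab
    have hb_not : img P b ∉ (orientedPath e a).dropLast := fun h => by
      rw [← hsplit, List.nodup_append] at hπnd
      exact hπnd.2.2 _ h _ (List.mem_singleton_self _) rfl
    rw [realize_cons_cons hD he hab, List.nodup_append]
    refine ⟨hπnd.sublist (List.dropLast_sublist _), ih, fun x hx y hy hxy => ?_⟩
    subst hxy
    have hxπ : x ∈ e.2.2 := mem_orientedPath.mp (List.dropLast_subset _ hx)
    rcases List.mem_cons.mp hy with rfl | hy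
    · exact hb_not hx
    · obtain ⟨e', he', u, w, huw, hu, hw, hxe'⟩ := mem_realizeTail hy
      by_cases hee : e' = e
      · subst hee
        rcases hab.mem_of_hasEnds huw with rfl | rfl
        · exact hanot hu
        · exact hanot (List.mem_cons_of_mem b hw)
      · have hxP : x ∈ P := hD.mem_of_mem_mem he he' (Ne.symm hee) hxπ hxe'
        obtain ⟨-, -, -, -, -, -, -, hint⟩ := hD.2.1 e he
        have hends : P[a]? = some x ∨ P[b]? = some x := by
          rcases hab with ⟨h1, h2⟩ | ⟨h1, h2⟩
          · rw [← h1, ← h2]; exact hint x hxπ hxP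
          · rw [← h1, ← h2]; exact (hint x hxπ hxP).symm
        rcases hends with hxa | hxb
        · -- `x` is the image of `a`, so `a` is an end of `e'`, hence occurs in `b :: l`
          rcases huw.eq_or_eq_of_isEnd (isEnd_of_mem_of_getElem? hD he' hxe' hxa) with rfl | rfl
          · exact hanot hu
          · exact hanot (List.mem_cons_of_mem b hw)
        · rw [getElem?_eq_some_img (hab.lt_length hD he), Option.some.injEq] at hxb
          exact hb_not (hxb ▸ hx)

/-- Under **uniform edge length** `ℓ` (every drawn edge realised by a path with `ℓ + 1` points),
the realisation of an abstract chain with `k` steps has `ℓ k + 1` points.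
[cite: LiskiewiczOgiharaToda2003, §4 (proof of Theorem 7: "e is realized by a path of length L²", h = L²(N+1))] -/
theorem length_realize (hD : IsGridDrawing P D) {ℓ : ℕ} (hU : ∀ e ∈ D, e.2.2.length = ℓ + 1) :
    ∀ {a : ℕ} {l : List ℕ}, List.IsChain (DAdj D) (a :: l) →
      (realize P D (a :: l)).length = ℓ * l.length + 1
  | a, [], _ => by simp [realize, realizeTail]
  | a, b :: l, hch => by
    obtain ⟨e, he, (hab : HasEnds e a b)⟩ := (List.isChain_cons_cons.mp hch).1
    rw [realize_cons_cons hD he hab, List.length_append, List.length_dropLast, length_orientedPath,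
      hU e he, length_realize hD hU (List.isChain_cons_cons.mp hch).2, List.length_cons]
    simp only [Nat.add_sub_cancel]
    ring

/-! ### The abstract path read off a walk; realisation is injective -/

/-- **The abstract vertex list read off a walk**: the indices of its points that are vertex
images, in order. [folklore] -/
def abstractOf (P : List GridPoint) (ω : List GridPoint) : List ℕ :=
  (ω.filter fun p => decide (p ∈ P)).map fun p => P.idxOf p

/-- `abstractOf` is additive over concatenation. [folklore] -/
theorem abstractOf_append (P : List GridPoint) (ω ω' : List GridPoint) :
    abstractOf P (ω ++ ω') = abstractOf P ω ++ abstractOf P ω' := by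
  simp [abstractOf, List.filter_append, List.map_append]

/-- The `dropLast` of the oriented path of a drawn edge at `a` reads off `[a]`: its head is the
image of `a` and its other points are interior. [folklore] -/
theorem abstractOf_dropLast_orientedPath (hD : IsGridDrawing P D) {e : DrawnEdge} (he : e ∈ D)
    {a : ℕ} (ha : e.1 = a ∨ e.2.1 = a) : abstractOf P (orientedPath e a).dropLast = [a] := by
  have halt : a < P.length := lt_length_of_isEnd hD he ha
  have hlen := two_le_length_orientedPath hD he a
  obtain ⟨y, t, hyt⟩ : ∃ y t, (orientedPath e a).tail = y :: t := by
    match h : (orientedPath e a).tail with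
    | [] => rw [← List.length_eq_zero_iff, List.length_tail] at h; omega
    | y :: t => exact ⟨y, t, rfl⟩
  have hπ : orientedPath e a = img P a :: y :: t := by rw [← hyt]; exact orientedPath_eq_cons hD he ha
  have hint : ∀ x ∈ (y :: t).dropLast, x ∉ P := by
    intro x hx
    obtain ⟨i, hi, rfl⟩ := List.mem_iff_getElem.mp hx
    rw [List.getElem_dropLast]
    rw [List.length_dropLast, List.length_cons] at hi
    have hi' : i + 1 + 1 < (orientedPath e a).length := by rw [hπ]; simp; omega
    have h := getElem_orientedPath_not_mem hD he a (k := i + 1) (Nat.succ_pos i) hi'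
    simp only [hπ, List.getElem_cons_succ] at h
    exact h
  rw [hπ, List.dropLast_cons_cons, abstractOf, List.filter_cons_of_pos (by
    simp [img_eq_getElem halt, List.getElem_mem halt])]
  rw [List.filter_eq_nil_iff.mpr (fun x hx => by simpa using hint x hx)]
  simp [img_eq_getElem halt, hD.1.idxOf_getElem a halt]

/-- **`abstractOf` is a left inverse of `realize`** on abstract simple paths. [folklore] -/
theorem abstractOf_realize (hD : IsGridDrawing P D) :
    ∀ {a : ℕ} {l : List ℕ}, IsAbsPath P.length D (a :: l) → abstractOf P (realize P D (a :: l)) = a :: l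
  | a, [], ⟨_, hlt, _⟩ => by
    have ha : a < P.length := hlt a List.mem_cons_self
    simp [abstractOf, realize, realizeTail, img_eq_getElem ha, List.getElem_mem ha,
      hD.1.idxOf_getElem a ha]
  | a, b :: l, ⟨hnd, hlt, hch⟩ => by
    obtain ⟨e, he, (hab : HasEnds e a b)⟩ := (List.isChain_cons_cons.mp hch).1
    have hpath' : IsAbsPath P.length D (b :: l) :=
      ⟨hnd.of_cons, fun v hv => hlt v (List.mem_cons_of_mem a hv), (List.isChain_cons_cons.mp hch).2⟩
    rw [realize_cons_cons hD he hab, abstractOf_append, abstractOf_realize hD hpath',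
      abstractOf_dropLast_orientedPath hD he hab.fst_or_snd, List.singleton_append]

/-- `abstractOf` is a left inverse of `realize` on non-empty abstract simple paths. [folklore] -/
theorem abstractOf_realize' (hD : IsGridDrawing P D) {l : List ℕ} (h : IsAbsPath P.length D l)
    (hne : l ≠ []) : abstractOf P (realize P D l) = l := by
  match l, hne with
  | a :: l, _ => exact abstractOf_realize hD h

/-! ### Hamiltonian paths and the counting identity -/

/-- Hamiltonian `s`–`t` paths are the abstract simple paths through all `N` vertices from `s`
to `t`. [cite: LiskiewiczOgiharaToda2003, §2.3 (#HamPath)] -/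
theorem isHamPath_iff {N : ℕ} {D : List DrawnEdge} {s t : ℕ} {l : List ℕ} :
    IsHamPath N D s t l ↔
      IsAbsPath N D l ∧ l.length = N ∧ l.head? = some s ∧ l.getLast? = some t := by
  constructor
  · rintro ⟨hperm, hhead, hlast, hch⟩
    refine ⟨⟨hperm.nodup_iff.mpr (List.nodup_range), fun v hv => ?_, hch⟩, ?_, hhead, hlast⟩
    · exact List.mem_range.mp (hperm.subset hv)
    · rw [hperm.length_eq, List.length_range]
  · rintro ⟨⟨hnd, hlt, hch⟩, hlen, hhead, hlast⟩
    refine ⟨?_, hhead, hlast, hch⟩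
    exact (List.subperm_of_subset hnd fun v hv => List.mem_range.mpr (hlt v hv)).perm_of_length_le
      (by rw [List.length_range, hlen])

/-- A vertex of `E₀` witnesses a drawn edge (with at least two points). [folklore] -/
theorem exists_edge_of_mem_vertexSet {x : GridPoint} (hx : x ∈ vertexSet (drawnEdges D)) :
    ∃ e ∈ D, 2 ≤ e.2.2.length := by
  simp only [vertexSet, List.mem_toFinset, List.mem_append, List.mem_map] at hx
  obtain ⟨q, hq, -⟩ | ⟨q, hq, -⟩ := hx <;>
  · obtain ⟨e, he, hq⟩ := List.mem_flatMap.mp hq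
    refine ⟨e, he, ?_⟩
    match h : e.2.2, hq with
    | [], hq => simp at hq
    | [_], hq => simp at hq
    | _ :: _ :: _, _ => simp

/-- **The counting identity of the tower step (uniform drawings).** Let `(P, D)` be a
congestion-free grid drawing of a graph of maximum degree three with `N ≥ 2` vertices in which
every edge is realised by a path with exactly `ℓ + 1` points ("for all edges `e` of `G′`, `e` is
realized by a path of length `L²`"). Then for vertices `s`, `t` the self-avoiding walks of the
realised subgraph `E₀ = drawnEdges D` from the image of `s` to the image of `t` having exactly
`ℓ (N - 1) + 1` points (i.e. length `h = ℓ (N - 1)`) are equinumerous with the Hamiltonian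
`s`–`t` paths of the graph: "every Hamiltonian path of `G′` is realized by a path in `E₂` of
length `h`. Furthermore, every path in `E₂` having length `h` corresponds to a Hamiltonian path
in `G′`. So … the number of SAWs in `E₂` having length `h` is exactly the number of Hamiltonian
paths in `G′`." (The bijection is `realize`/`abstractOf`; `N ≥ 2` excludes the one-vertex graph,
whose Hamiltonian path `[0]` has no counterpart walk in the empty edge list.)
[cite: LiskiewiczOgiharaToda2003, Theorem 7 (proof, types (1)–(3): "the number of SAWs in E₂ having length h is exactly the number of Hamiltonian paths in G′")] -/
theorem ncard_saw_fixedLength_eq_hamPathCount (hD : IsGridDrawing P D) {ℓ : ℕ}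
    (hU : ∀ e ∈ D, e.2.2.length = ℓ + 1) (hN : 2 ≤ P.length) {s t : ℕ} (hs : s < P.length)
    (ht : t < P.length) :
    {ω : List GridPoint | IsSAWIn (drawnEdges D) ω ∧ ω.head? = some P[s] ∧
        ω.getLast? = some P[t] ∧ ω.length = ℓ * (P.length - 1) + 1}.ncard =
      hamPathCount P.length D s t := by
  set S := {ω : List GridPoint | IsSAWIn (drawnEdges D) ω ∧ ω.head? = some P[s] ∧
    ω.getLast? = some P[t] ∧ ω.length = ℓ * (P.length - 1) + 1} with hS
  set H := {l : List ℕ | IsHamPath P.length D s t l} with hH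
  -- realisations of Hamiltonian paths are walks of the required kind
  have hreal : ∀ l ∈ H, realize P D l ∈ S := by
    intro l hl
    obtain ⟨hpath, hlen, hhead, hlast⟩ := isHamPath_iff.mp hl
    match l, hhead, hlen with
    | [a], _, hlen => simp at hlen; omega
    | a :: b :: l, hhead, hlen =>
      simp only [List.head?_cons, Option.some.injEq] at hhead
      rw [hhead] at hpath hlast hlen ⊢
      have hlast' : (s :: b :: l).getLast (List.cons_ne_nil _ _) = t := by
        rw [List.getLast?_eq_some_getLast (List.cons_ne_nil _ _), Option.some.injEq] at hlast
        exact hlast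
      refine ⟨⟨List.cons_ne_nil _ _, nodup_realize hD hpath, fun x hx => ?_,
        isChain_realize hD hpath.2.2⟩, ?_, ?_, ?_⟩
      · obtain ⟨e, he, hxe⟩ := exists_mem_path_of_mem_realize hD hpath.2.2 x hx
        exact mem_vertexSet_of_mem_path hD he hxe
      · simp [realize, img_eq_getElem hs]
      · rw [getLast?_realize hD hpath.2.2, hlast', img_eq_getElem ht]
      · rw [length_realize hD hU hpath.2.2]
        simp only [List.length_cons] at hlen ⊢
        congr 1
        rw [← hlen, Nat.add_sub_cancel]
  -- every such walk is the realisation of a Hamiltonian path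
  have hsurj : ∀ ω ∈ S, ∃ l ∈ H, realize P D l = ω := by
    rintro ω ⟨hsaw, hhead, hlast, hlen⟩
    obtain ⟨l', hpath, hrealize⟩ :=
      exists_absPath_realize_eq hD ω.length rfl hsaw.2.2.2 hsaw.2.1 hs hhead ⟨t, ht, hlast⟩
    -- `ℓ ≥ 1`: the walk has a point, which is a vertex of `E₀`, so some edge is drawn
    have hℓ : 1 ≤ ℓ := by
      obtain ⟨p, hp⟩ := List.exists_mem_of_ne_nil ω hsaw.1
      obtain ⟨e, he, h2⟩ := exists_edge_of_mem_vertexSet (hsaw.2.2.1 p hp)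
      have := hU e he; omega
    have hlen' : l'.length = P.length - 1 := by
      rw [← hrealize, length_realize hD hU hpath.2.2] at hlen
      exact Nat.eq_of_mul_eq_mul_left hℓ (by omega)
    refine ⟨s :: l', isHamPath_iff.mpr ⟨hpath, by rw [List.length_cons, hlen']; omega, rfl, ?_⟩,
      hrealize⟩
    have h1 := getLast?_realize hD hpath.2.2
    rw [hrealize, hlast, Option.some.injEq] at h1
    set c := (s :: l').getLast (List.cons_ne_nil _ _) with hc
    have hclt : c < P.length := hpath.2.1 c (List.getLast_mem _)
    rw [img_eq_getElem hclt] at h1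
    have hct : t = c := (hD.1.getElem_inj_iff).mp h1
    rw [List.getLast?_eq_some_getLast (List.cons_ne_nil _ _), ← hc, hct]
  have hinj : Set.InjOn (realize P D) H := by
    intro l₁ h₁ l₂ h₂ heq
    obtain ⟨hp₁, -, hh₁, -⟩ := isHamPath_iff.mp h₁
    obtain ⟨hp₂, -, hh₂, -⟩ := isHamPath_iff.mp h₂
    have hne₁ : l₁ ≠ [] := by rintro rfl; simp at hh₁
    have hne₂ : l₂ ≠ [] := by rintro rfl; simp at hh₂
    rw [← abstractOf_realize' hD hp₁ hne₁, ← abstractOf_realize' hD hp₂ hne₂, heq]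
  have hSH : S = realize P D '' H := by
    ext ω
    exact ⟨fun h => let ⟨l, hl, hlω⟩ := hsurj ω h; ⟨l, hl, hlω⟩, fun ⟨l, hl, hlω⟩ => hlω ▸ hreal l hl⟩
  rw [hSH, hinj.ncard_image]
  rfl

end Drawing

/-! ### Moving the start point to the origin -/

/-- Adjacency is translation invariant. [folklore] -/
theorem adj_translate_iff (v : GridPoint) (E : EdgeList) (x y : GridPoint) :
    Adj (translate v E) (x + v) (y + v) ↔ Adj E x y := by
  have hinj : Function.Injective fun e : GridPoint × GridPoint => (e.1 + v, e.2 + v) := by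
    rintro ⟨a, b⟩ ⟨c, d⟩ h
    simp only [Prod.mk.injEq, add_left_inj] at h
    rw [h.1, h.2]
  unfold Adj translate
  rw [show ((x + v, y + v) : GridPoint × GridPoint) = (fun e => (e.1 + v, e.2 + v)) (x, y) from rfl,
    show ((y + v, x + v) : GridPoint × GridPoint) = (fun e => (e.1 + v, e.2 + v)) (y, x) from rfl,
    List.mem_map_of_injective hinj, List.mem_map_of_injective hinj]

/-- The vertex set is translation covariant. [folklore] -/
theorem mem_vertexSet_translate_iff (v : GridPoint) (E : EdgeList) (x : GridPoint) :
    x + v ∈ vertexSet (translate v E) ↔ x ∈ vertexSet E := by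
  simp only [vertexSet, translate, List.map_map, List.mem_toFinset, List.mem_append, List.mem_map,
    Function.comp_apply]
  constructor
  · rintro (⟨e, he, h⟩ | ⟨e, he, h⟩)
    · exact Or.inl ⟨e, he, add_right_cancel h⟩
    · exact Or.inr ⟨e, he, add_right_cancel h⟩
  · rintro (⟨e, he, h⟩ | ⟨e, he, h⟩)
    · exact Or.inl ⟨e, he, by rw [h]⟩
    · exact Or.inr ⟨e, he, by rw [h]⟩

/-- **Self-avoiding walks are translation covariant**: `ω + v` is a SAW of `E + v` iff `ω` is a
SAW of `E`. [cite: LiskiewiczOgiharaToda2003, §4 (proof of Theorem 7: "we will shift the embedding accordingly so that s′ is located on (0, 0)")] -/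
theorem isSAWIn_translate_iff (v : GridPoint) (E : EdgeList) (ω : List GridPoint) :
    IsSAWIn (translate v E) (ω.map fun p => p + v) ↔ IsSAWIn E ω := by
  unfold IsSAWIn
  rw [List.nodup_map_iff (add_left_injective v), List.forall_mem_map, List.isChain_map]
  simp only [ne_eq, List.map_eq_nil_iff, mem_vertexSet_translate_iff, adj_translate_iff]

/-- **Counting from the origin**: the number of SAWs of `E - a` from the origin to `b - a` with
`n + 1` points is the number of SAWs of `E` from `a` to `b` with `n + 1` points.
[cite: LiskiewiczOgiharaToda2003, §4 (proof of Theorem 7, E₀: start point moved to the origin)] -/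
theorem sawCountFixedLength_translate (E : EdgeList) (a b : GridPoint) (n : ℕ) :
    sawCountFixedLength (translate (-a) E) (b - a) n =
      {ω : List GridPoint | IsSAWIn E ω ∧ ω.head? = some a ∧ ω.getLast? = some b ∧
        ω.length = n + 1}.ncard := by
  unfold sawCountFixedLength
  have hinj : Function.Injective (List.map fun p : GridPoint => p + -a) :=
    List.map_injective_iff.mpr (add_left_injective _)
  have hset : {ω ∈ sawsFromOriginTo (translate (-a) E) (b - a) | ω.length = n + 1} =
      (List.map fun p : GridPoint => p + -a) ''
        {ω : List GridPoint | IsSAWIn E ω ∧ ω.head? = some a ∧ ω.getLast? = some b ∧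
          ω.length = n + 1} := by
    ext ω'
    simp only [sawsFromOriginTo, Set.mem_setOf_eq, Set.mem_image]
    constructor
    · rintro ⟨⟨hsaw, hhead, hlast⟩, hlen⟩
      refine ⟨ω'.map fun p => p + a, ⟨?_, ?_, ?_, ?_⟩, ?_⟩
      · rw [← isSAWIn_translate_iff (-a)]
        simpa [List.map_map, Function.comp_def] using hsaw
      · rw [List.head?_map, hhead]; simp [gridOrigin]
      · rw [List.getLast?_map, hlast]; simp
      · simpa using hlen
      · simp [List.map_map, Function.comp_def]
    · rintro ⟨ω, ⟨hsaw, hhead, hlast, hlen⟩, rfl⟩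
      refine ⟨⟨(isSAWIn_translate_iff (-a) E ω).mpr hsaw, ?_, ?_⟩, by simpa using hlen⟩
      · rw [List.head?_map, hhead, Option.map_some, add_neg_cancel]; rfl
      · rw [List.getLast?_map, hlast]; simp [sub_eq_add_neg]
  rw [hset, Set.ncard_image_of_injective _ hinj]

section Drawing

variable {P : List GridPoint} {D : List DrawnEdge}

/-- **The counting identity in instance form.** For a uniform congestion-free grid drawing with
`N ≥ 2` vertices, the version-(1) count of the translated realised subgraph `E₀ - P[s]` (a
subgraph of the grid, `isGridSubgraph_translate`/`isGridSubgraph_drawnEdges`) at the point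
`P[t] - P[s]` and length `ℓ (N - 1)` is the number of Hamiltonian `s`–`t` paths — the identity
`#HamPath(G′, s′, t′) = SAWCOUNT₁(E₂, τ, h)` behind `R₁(x) = (E₂, τ, h)`, for drawings that are
already uniform. [cite: LiskiewiczOgiharaToda2003, Theorem 7 (proof: "Define R₁(x) = (E₂, τ, h)")] -/
theorem sawCountFixedLength_drawnEdges_eq_hamPathCount (hD : IsGridDrawing P D) {ℓ : ℕ}
    (hU : ∀ e ∈ D, e.2.2.length = ℓ + 1) (hN : 2 ≤ P.length) {s t : ℕ} (hs : s < P.length)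
    (ht : t < P.length) :
    sawCountFixedLength (translate (-P[s]) (drawnEdges D)) (P[t] - P[s]) (ℓ * (P.length - 1)) =
      hamPathCount P.length D s t := by
  rw [sawCountFixedLength_translate]
  exact ncard_saw_fixedLength_eq_hamPathCount hD hU hN hs ht

/-- The number of Hamiltonian paths depends on the drawing only through the list of end pairs
of its edges (re-drawing the edges, as the tower construction does, does not change it).
[cite: LiskiewiczOgiharaToda2003, §4 (proof of Theorem 7: E₀, E₁, E₂ realise the same graph G′)] -/
theorem hamPathCount_eq_of_map_ends_eq {N : ℕ} {D D' : List DrawnEdge}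
    (h : D.map (fun e => (e.1, e.2.1)) = D'.map (fun e => (e.1, e.2.1))) (s t : ℕ) :
    hamPathCount N D s t = hamPathCount N D' s t := by
  have hadj : ∀ a b, DAdj D a b ↔ DAdj D' a b := by
    intro a b
    have key : ∀ (D₀ : List DrawnEdge), DAdj D₀ a b ↔
        ∃ p ∈ D₀.map (fun e => (e.1, e.2.1)), (p.1 = a ∧ p.2 = b) ∨ (p.1 = b ∧ p.2 = a) := by
      intro D₀
      simp only [DAdj, List.mem_map, exists_exists_and_eq_and]
    rw [key, key, h]
  unfold hamPathCount IsHamPath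
  congr 1
  ext l
  simp only [Set.mem_setOf_eq]
  rw [List.IsChain.iff hadj]

end Drawing

/-! ### Sanity checks (the one-edge drawing of `GridSAWCountingViaGridHamPath.lean`) -/

/-- The realisation of the abstract path `[0, 1]` in the one-edge drawing is the drawn edge
`(0,0), (0,1)` itself. [folklore] -/
theorem realize_oneEdge :
    realize oneEdgeDrawing.1 oneEdgeDrawing.2 [0, 1] = [((0 : ℤ), (0 : ℤ)), (0, 1)] := by
  decide

/-- … and reading the vertex images off that walk gives back `[0, 1]`. [folklore] -/
theorem abstractOf_oneEdge :
    abstractOf oneEdgeDrawing.1 [((0 : ℤ), (0 : ℤ)), (0, 1)] = [0, 1] := by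
  decide

/-- The one-edge drawing is uniform with `ℓ = 1`. [folklore] -/
theorem oneEdge_uniform : ∀ e ∈ oneEdgeDrawing.2, e.2.2.length = 1 + 1 := by
  decide

/-- Non-vacuity of the counting identity: on the one-edge drawing (`N = 2`, `ℓ = 1`, `s = 0`,
`t = 1`, one Hamiltonian path by `hamPathCount_oneEdge`) it yields exactly one SAW of length `1`
from the origin to `(0, 1)` in the one-edge graph. [folklore] -/
theorem sawCountFixedLength_oneEdge :
    sawCountFixedLength (translate (-((0 : ℤ), (0 : ℤ))) [(((0 : ℤ), (0 : ℤ)), (0, 1))])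
      ((0, 1) - (0, 0)) (1 * (2 - 1)) = 1 := by
  have h := sawCountFixedLength_drawnEdges_eq_hamPathCount (s := 0) (t := 1)
    isGridDrawing_oneEdge oneEdge_uniform (by decide) (by decide) (by decide)
  have hlen : oneEdgeDrawing.1.length = 2 := rfl
  have h0 : oneEdgeDrawing.1[0] = ((0 : ℤ), (0 : ℤ)) := rfl
  have h1 : oneEdgeDrawing.1[1] = ((0 : ℤ), (1 : ℤ)) := rfl
  simp only [hlen, h0, h1, hamPathCount_oneEdge, drawnEdges_oneEdge] at h
  exact h

end Literature.Barriers.CriticalPhenomena.GridSAW
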